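import Literature.Analysis.FluidPDE.ExtremeGrowthBlowupWindowLower
import Literature.Analysis.FluidPDE.TorusNSChessboardTimeAverages
import HarnessLib

/-!
# The a-priori `L^q` space–time bound and the lower edge of the `L^q` blow-up window on `T³`

Analysis/FluidPDE theorem file, sequel of `ExtremeGrowthBlowupWindowLower.lean` (BOUNDS.md (2.5)/(2.6)
of the fluid-computer cell). Protas 2026 (essay), §4.1: the `L^q` norms of a Navier–Stokes flow on
`[0, T]` are "subject to a priori bounds valid also for Leray-Hopf weak solutions",
eq. (44) (p. 62):
`∫₀ᵀ ‖u(τ)‖_{L^q}^{4q/(3(q−2))} dτ ≤ C K₀^{2q/(3(q−2))}`, `2 ≤ q ≤ 6`,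
and "leveraging a priori estimates (44) and Grönwall's lemma … we arrive at upper bounds on the
rate of growth of the `L^q` norm that ensure there is no blow-up in finite time",
eq. (50) (p. 65), first line: `d/dt ‖u(t)‖_{L^q} ≤ C ‖u(t)‖_{L^q}^{(7q−6)/(3(q−2))}`, `2 ≤ q ≤ 6`.

The predecessor file proved the pure real-variable half (a rate `y' ≤ C y^{1+s}` cannot blow up while
a primitive of `y^s` stays bounded) and left (44) as literature. Here (44) and the resulting
no-blow-up statement are PROVED on the unit torus `T^d`, `card d = 3`, for classical solutions of
the unforced Navier–Stokes equations with mean-zero velocity slices (`ν > 0`), `2 < q ≤ 6`, with an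
existential constant depending only on `d` (the tree's `L⁶` Sobolev constant) and the printed
dependence on the initial energy `K₀ = K(u(a))`:

* `exists_lSixEnstrophyConst` / `lSixEnstrophyConst` / `rpow_third_integral_norm_pow_six_le` — the
  mean-zero Sobolev inequality in enstrophy form, `‖v‖_{L⁶}² = (∫‖v‖⁶)^{1/3} ≤ c ℰ(v)`
  (`ℰ = ½‖∇v‖₂²`; from the tree's `Torus.exists_integral_norm_pow_six_le_gradNormSq_cube`,
  Robinson–Rodrigo–Sadowski 2016 Thm 1.18, by taking cube roots).
* `rpow_integral_norm_rpow_le_energy_rpow_mul_enstrophy` — the pointwise-in-time integrand of (44)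
  for `2 < q < 6`: `‖v‖_{L^q}^{4q/(3(q−2))} = (∫‖v‖^q)^{4/(3(q−2))} ≤ (2K(v))^{(6−q)/(3(q−2))} · c ℰ(v)`
  (the tree's `L²`–`L⁶` interpolation `Torus.integral_rpow_le_interpolate_two_six'`, RRS16 proof of
  Lemma 8.16, raised to the power `4/(3(q−2))`).
* `integral_rpow_third_integral_norm_pow_six_le` (`q = 6`) and
  `integral_rpow_integral_norm_rpow_le` (`2 < q < 6`) — **eq. (44) on `T³`**: along a classical
  mean-zero solution on `[a, b]`,
  `∫ₐᵇ ‖u(t)‖_{L^q}^{4q/(3(q−2))} dt ≤ c (2K(u(a)))^{(6−q)/(3(q−2))} (K(u(a)) − K(u(b)))/(2ν)`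
  (energy identity `K(b) − K(a) = −2ν∫ₐᵇ ℰ`, `kineticEnergy_sub_eq_neg_two_mul_integral_torusEnstrophy`,
  and `K(u(t)) ≤ K(u(a))`), i.e. `≤ c' K₀^{2q/(3(q−2))}/ν` with `(6−q)/(3(q−2)) + 1 = 2q/(3(q−2))`
  (`aprioriEnergyExponent_add_one`).
* `le_mul_exp_of_deriv_le_mul_rpow_third` (`q = 6`) and `le_mul_exp_of_deriv_le_mul_lqFactor`
  (`2 < q < 6`) — **the lower edge of the window, eq. (50) first line, as a theorem**: if a
  nonnegative `y` has one-sided derivatives within `[a, b]` with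
  `y'(t) ≤ A · y(t) · ‖u(t)‖_{L^q}^{4q/(3(q−2))}`, `A ≥ 0`, then
  `y(t) ≤ y(a) · exp(A c (2K₀)^{(6−q)/(3(q−2))} (K₀ − K(u(t)))/(2ν)) ≤ y(a) · exp(A c' K₀^{2q/(3(q−2))}/ν)`
  for all `t ∈ [a, b]` — uniformly in `b` (differential Grönwall with the continuous coefficient
  `k = A c (2K₀)^{…} ℰ(u(·))`, tree `le_mul_exp_integral_of_hasDerivWithinAt_le_mul`).
* `lqNorm_le_mul_exp_of_rate_le_rpow_edge` — the dictionary made literal: if moreover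
  `y(t) = ‖u(t)‖_{L^q} = (∫‖u(t)‖^q)^{1/q}`, the hypothesis `y' ≤ A y^{(7q−6)/(3(q−2))}` (the printed
  edge exponent, `one_add_aprioriExponent_eq` of the predecessor) IS `y' ≤ A y ‖u‖_q^{4q/(3(q−2))}`
  (`rpow_inv_mul_rpow_aprioriFactor_eq`), so `‖u(t)‖_{L^q} ≤ ‖u(a)‖_{L^q} exp(…)`: a growth rate at (or
  below) the lower edge of (50) sustained on any window cannot blow up.

Scope (faithfulness): classical solutions with mean-zero slices on the unit torus (the essay's
setting is the periodic box; (44) is stated there for Leray–Hopf solutions — here only the smooth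
case, which is what the cell's optimiser produces); `q = 2` (where `4q/(3(q−2)) = ∞`) is excluded and
`q = 6` is treated separately (`s = 2`); the differentiability of `t ↦ ‖u(t)‖_{L^q}` is a HYPOTHESIS
of the edge theorems (one-sided derivatives within the window, as for `ℰ` in the predecessor), not
proved; constants are existential (the tree's Sobolev constant is). The `q > 6` line of (50) needs
`u ∈ L¹(0,T; L^∞)` (RRS16 Lemma 8.15 + Agmon) and is NOT here. Nothing here asserts that any
Navier–Stokes flow realises a given rate. Search for candidate a priori estimates; no regularity
claim.

## Mathlib / tree search

Tree (used): `Torus.exists_integral_norm_pow_six_le_gradNormSq_cube` (`TorusNSChessboardTimeAverages`),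
`Torus.integral_rpow_le_interpolate_two_six'` (`TorusNSBeiraoDaVeigaCriterion`),
`le_mul_exp_integral_of_hasDerivWithinAt_le_mul`, `kineticEnergy_sub_eq_neg_two_mul_integral_torusEnstrophy`,
`kineticEnergy_le_of_le` (`ExtremeGrowthVorticityControl`),
`Torus.IsClassicalNSSolutionOn.hasDerivWithinAt_half_gradNormSq` (`TorusClassicalH1Balance`),
`gradNormSq_eq_two_mul_torusEnstrophy` (`ExtremeGrowthBounds`), `one_add_aprioriExponent_eq`
(`ExtremeGrowthBlowupWindowLower`). Mathlib: `Real.rpow_le_rpow`, `Real.mul_rpow`, `Real.rpow_mul`,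
`Real.pow_rpow_inv_natCast`, `Real.rpow_add'`, `MeasureTheory.integral_mono_of_nonneg`,
`ContinuousOn.integrableOn_Icc`.

## References

* B. Protas, *Extreme flows: where physics meets mathematically rigorous bounds* (essay, 2026),
  arXiv:2608.04859, §4.1, eq. (44) (p. 62) and eq. (50) (p. 65). [Protas2026]
* D. Kang, B. Protas, *Searching for singularities in Navier–Stokes flows based on the
  Ladyzhenskaya–Prodi–Serrin conditions*, J. Nonlinear Sci. 32 (2022), the explicit form of (44).
  [KangProtas2022]
* J. C. Robinson, J. L. Rodrigo, W. Sadowski, *The Three-Dimensional Navier–Stokes Equations*,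
  CUP 2016, Thm 1.18 (`H¹ ⊂ L⁶` on `T³`), Lemma 3.5 (the Leray–Hopf class `L^r(0,T;L^s)`,
  `2/r + 3/s = 3/2`), proof of Lemma 8.16 (the `L²`–`L⁶` interpolation). [RobinsonRodrigoSadowskiCUP2016]
-/

noncomputable section

open Set MeasureTheory intervalIntegral
open scoped InnerProductSpace RealInnerProductSpace

namespace Literature.Analysis.FluidPDE

open Literature.Analysis.FunctionSpaces

variable {d : Type*} [Fintype d] [DecidableEq d]

/-! ## Exponent bookkeeping (pure arithmetic) -/

section Exponents

omit [Fintype d] [DecidableEq d]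

/-- The energy exponent of (44): `(6 − q)/(3(q − 2)) + 1 = 2q/(3(q − 2))` (`q ≠ 2`), so that
`(2K₀)^{(6−q)/(3(q−2))} · K₀ ∝ K₀^{2q/(3(q−2))}`. [cite: Protas2026, §4.1, eq. (44), p. 62] -/
theorem aprioriEnergyExponent_add_one {q : ℝ} (hq : q ≠ 2) :
    (6 - q) / (3 * (q - 2)) + 1 = 2 * q / (3 * (q - 2)) := by
  have h : q - 2 ≠ 0 := sub_ne_zero.2 hq
  field_simp
  ring

/-- The interpolation exponents of (44): `((6 − q)/4) · (4/(3(q − 2))) = (6 − q)/(3(q − 2))` and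
`((q − 2)/4) · (4/(3(q − 2))) = 1/3` (`q ≠ 2`). [cite: Protas2026, §4.1, eq. (44), p. 62] -/
theorem interpolationExponents_mul {q : ℝ} (hq : q ≠ 2) :
    (6 - q) / 4 * (4 / (3 * (q - 2))) = (6 - q) / (3 * (q - 2)) ∧
      (q - 2) / 4 * (4 / (3 * (q - 2))) = 1 / 3 := by
  have h : q - 2 ≠ 0 := sub_ne_zero.2 hq
  constructor
  · field_simp
  · field_simp

/-- The dictionary between the edge exponent of (50) and the a-priori factor of (44): for `I ≥ 0`
and `2 < q`, `I^{1/q} · I^{4/(3(q−2))} = (I^{1/q})^{(7q−6)/(3(q−2))}` — with `I = ∫‖u‖^q`,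
`‖u‖_{L^q} · ‖u‖_{L^q}^{4q/(3(q−2))} = ‖u‖_{L^q}^{(7q−6)/(3(q−2))}`.
[cite: Protas2026, §4.1, eqs. (44) and (50)] -/
theorem rpow_inv_mul_rpow_aprioriFactor_eq {I q : ℝ} (hI : 0 ≤ I) (hq : 2 < q) :
    I ^ (1 / q) * I ^ (4 / (3 * (q - 2))) = (I ^ (1 / q)) ^ ((7 * q - 6) / (3 * (q - 2))) := by
  have hq0 : 0 < q := by linarith
  have hq2 : 0 < q - 2 := by linarith
  have hsum : 1 / q + 4 / (3 * (q - 2)) = 1 / q * ((7 * q - 6) / (3 * (q - 2))) := by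
    field_simp
    ring
  have hne : 1 / q + 4 / (3 * (q - 2)) ≠ 0 := by positivity
  rw [← Real.rpow_add' hI hne, hsum, Real.rpow_mul hI]

end Exponents

/-! ## The mean-zero Sobolev inequality in enstrophy form: `‖v‖_{L⁶}² ≤ c ℰ(v)` -/

section Sobolev

/-- **`‖v‖_{L⁶}² ≤ c ℰ(v)` on `T³`.** On `T^d`, `card d = 3`, there is `c ≥ 0` with
`(∫‖v‖⁶)^{1/3} ≤ c · ℰ(v)` for every smooth mean-zero field `v` (cube root of the tree's
`∫‖v‖⁶ ≤ C (∫|∇v|²)³`, `ℰ = ½∫|∇v|²`; `c = 2C^{1/3}`).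
[cite: RobinsonRodrigoSadowskiCUP2016, Thm 1.18 (H¹ ⊂ L⁶ on T³, mean-zero form)] -/
theorem exists_lSixEnstrophyConst (hd : Fintype.card d = 3) :
    ∃ c : ℝ, 0 ≤ c ∧ ∀ v : UnitAddTorus d → EuclideanSpace ℝ d, Torus.IsSmooth v →
      Torus.HasZeroMean v → (∫ x, ‖v x‖ ^ 6) ^ (1 / 3 : ℝ) ≤ c * torusEnstrophy v := by
  obtain ⟨C, hC0, hC⟩ := Torus.exists_integral_norm_pow_six_le_gradNormSq_cube (d := d) hd
  refine ⟨2 * C ^ (1 / 3 : ℝ), by positivity, fun v hv h0 => ?_⟩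
  have hG0 : 0 ≤ Torus.gradNormSq v := Torus.gradNormSq_nonneg v
  have hI0 : 0 ≤ ∫ x, ‖v x‖ ^ 6 := integral_nonneg fun x => by positivity
  have h1 : (∫ x, ‖v x‖ ^ 6) ^ (1 / 3 : ℝ) ≤ (C * Torus.gradNormSq v ^ 3) ^ (1 / 3 : ℝ) :=
    Real.rpow_le_rpow hI0 (hC v hv h0) (by norm_num)
  have h2 : (C * Torus.gradNormSq v ^ 3) ^ (1 / 3 : ℝ) = C ^ (1 / 3 : ℝ) * Torus.gradNormSq v := by
    rw [Real.mul_rpow hC0 (pow_nonneg hG0 3)]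
    congr 1
    rw [show ((1 : ℝ) / 3) = ((3 : ℕ) : ℝ)⁻¹ by norm_num]
    exact Real.pow_rpow_inv_natCast hG0 (by norm_num)
  have h3 : C ^ (1 / 3 : ℝ) * Torus.gradNormSq v = 2 * C ^ (1 / 3 : ℝ) * torusEnstrophy v := by
    rw [gradNormSq_eq_two_mul_torusEnstrophy]
    ring
  linarith [h1, h2, h3]

/-- The Sobolev–enstrophy constant `c = c(d) ≥ 0` of `exists_lSixEnstrophyConst` (a choice; only its
two defining properties below are used). [cite: RobinsonRodrigoSadowskiCUP2016, Thm 1.18] -/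
def lSixEnstrophyConst (hd : Fintype.card d = 3) : ℝ :=
  Classical.choose (exists_lSixEnstrophyConst (d := d) hd)

/-- `c ≥ 0`. [cite: RobinsonRodrigoSadowskiCUP2016, Thm 1.18] -/
theorem lSixEnstrophyConst_nonneg (hd : Fintype.card d = 3) : 0 ≤ lSixEnstrophyConst hd :=
  (Classical.choose_spec (exists_lSixEnstrophyConst (d := d) hd)).1

/-- **`‖v‖_{L⁶}² ≤ c ℰ(v)`** for smooth mean-zero `v` on `T³`, with the fixed constant
`c = lSixEnstrophyConst`. [cite: RobinsonRodrigoSadowskiCUP2016, Thm 1.18] -/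
theorem rpow_third_integral_norm_pow_six_le (hd : Fintype.card d = 3)
    {v : UnitAddTorus d → EuclideanSpace ℝ d} (hv : Torus.IsSmooth v) (h0 : Torus.HasZeroMean v) :
    (∫ x, ‖v x‖ ^ 6) ^ (1 / 3 : ℝ) ≤ lSixEnstrophyConst hd * torusEnstrophy v :=
  (Classical.choose_spec (exists_lSixEnstrophyConst (d := d) hd)).2 v hv h0

omit [DecidableEq d] in
/-- `∫‖v‖² = 2K(v)` (`K(u) := ½‖u‖²_{L²}`). [cite: Protas2026, §2, eq. (14), p. 18] -/
theorem integral_norm_sq_eq_two_mul_kineticEnergy (v : UnitAddTorus d → EuclideanSpace ℝ d) :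
    ∫ x, ‖v x‖ ^ 2 = 2 * Torus.kineticEnergy v := by
  unfold Torus.kineticEnergy
  ring

/-- **The integrand of (44), `2 < q < 6`, pointwise in time**: for a smooth mean-zero `v` on `T³`,
`‖v‖_{L^q}^{4q/(3(q−2))} = (∫‖v‖^q)^{4/(3(q−2))} ≤ (2K(v))^{(6−q)/(3(q−2))} · c ℰ(v)`
(`L²`–`L⁶` interpolation raised to the power `4/(3(q−2))`, then `‖v‖₆² ≤ c ℰ`).
[cite: Protas2026, §4.1, eq. (44), p. 62] [cite: RobinsonRodrigoSadowskiCUP2016, Lemma 8.16 (proof, interpolation step)] -/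
theorem rpow_integral_norm_rpow_le_energy_rpow_mul_enstrophy (hd : Fintype.card d = 3) {q : ℝ}
    (hq2 : 2 < q) (hq6 : q < 6) {v : UnitAddTorus d → EuclideanSpace ℝ d} (hv : Torus.IsSmooth v)
    (h0 : Torus.HasZeroMean v) :
    (∫ x, ‖v x‖ ^ q) ^ (4 / (3 * (q - 2))) ≤
      (2 * Torus.kineticEnergy v) ^ ((6 - q) / (3 * (q - 2))) *
        (lSixEnstrophyConst hd * torusEnstrophy v) := by
  have hqne : q ≠ 2 := ne_of_gt hq2
  have he0 : 0 ≤ 4 / (3 * (q - 2)) := by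
    have : 0 < q - 2 := by linarith
    positivity
  have hvc : Continuous fun x => ‖v x‖ := hv.continuous.norm
  have hH := Torus.integral_rpow_le_interpolate_two_six' hq2 hq6 hvc (fun x => norm_nonneg _)
  have hIq : 0 ≤ ∫ x, ‖v x‖ ^ q := integral_nonneg fun x => Real.rpow_nonneg (norm_nonneg _) _
  have hI2 : 0 ≤ ∫ x, ‖v x‖ ^ 2 := integral_nonneg fun x => by positivity
  have hI6 : 0 ≤ ∫ x, ‖v x‖ ^ 6 := integral_nonneg fun x => by positivity
  -- raise the interpolation inequality to the power `4/(3(q−2))`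
  have h1 := Real.rpow_le_rpow hIq hH he0
  rw [Real.mul_rpow (Real.rpow_nonneg hI2 _) (Real.rpow_nonneg hI6 _), ← Real.rpow_mul hI2,
    ← Real.rpow_mul hI6, (interpolationExponents_mul hqne).1, (interpolationExponents_mul hqne).2,
    integral_norm_sq_eq_two_mul_kineticEnergy] at h1
  refine h1.trans ?_
  exact mul_le_mul_of_nonneg_left (rpow_third_integral_norm_pow_six_le hd hv h0)
    (Real.rpow_nonneg (by linarith [Torus.kineticEnergy_nonneg v]) _)

end Sobolev

/-! ## Eq. (44) along classical solutions: `q = 6` and `2 < q < 6` -/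

section APriori

variable {ν a b : ℝ} {u : ℝ → UnitAddTorus d → EuclideanSpace ℝ d} {p : ℝ → UnitAddTorus d → ℝ}

/-- **`‖u(t)‖_{L⁶}² ≤ c ℰ(u(t))` along a classical solution with mean-zero slices.**
[cite: RobinsonRodrigoSadowskiCUP2016, Thm 1.18] -/
theorem rpow_third_integral_norm_pow_six_le_of_solution (hd : Fintype.card d = 3)
    (h : Torus.IsClassicalNSSolutionOn (Icc a b) ν 0 u p)
    (hmean : ∀ t ∈ Icc a b, Torus.HasZeroMean (u t)) {t : ℝ} (ht : t ∈ Icc a b) :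
    (∫ x, ‖u t x‖ ^ 6) ^ (1 / 3 : ℝ) ≤ lSixEnstrophyConst hd * torusEnstrophy (u t) :=
  rpow_third_integral_norm_pow_six_le hd (h.smooth_velocity.isSmooth_slice ht) (hmean t ht)

/-- **Eq. (44) at `q = 6` on `T³`**: along a classical solution of the unforced Navier–Stokes
equations (`ν > 0`, mean-zero slices) on `[a, b]`,
`∫ₐᵇ ‖u(t)‖_{L⁶}² dt ≤ c (K(u(a)) − K(u(b)))/(2ν) (≤ c K₀/(2ν))` — the Leray–Hopf class
`L²(0,T;L⁶)` with its constant (`‖u‖₆² ≤ c ℰ` integrated against the energy identity).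
[cite: Protas2026, §4.1, eq. (44), p. 62 (q = 6)] [cite: RobinsonRodrigoSadowskiCUP2016, Lemma 3.5] -/
theorem integral_rpow_third_integral_norm_pow_six_le (hd : Fintype.card d = 3) (hν : 0 < ν)
    (hab : a < b) (h : Torus.IsClassicalNSSolutionOn (Icc a b) ν 0 u p)
    (hmean : ∀ t ∈ Icc a b, Torus.HasZeroMean (u t)) :
    ∫ t in a..b, (∫ x, ‖u t x‖ ^ 6) ^ (1 / 3 : ℝ) ≤
      lSixEnstrophyConst hd * (Torus.kineticEnergy (u a) - Torus.kineticEnergy (u b)) / (2 * ν) := by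
  set c : ℝ := lSixEnstrophyConst hd with hc
  have hcont : ContinuousOn (fun s => c * torusEnstrophy (u s)) (Icc a b) :=
    fun s hs => ((h.hasDerivWithinAt_half_gradNormSq hab hs).continuousWithinAt).const_smul c
  have hmono : ∫ t in a..b, (∫ x, ‖u t x‖ ^ 6) ^ (1 / 3 : ℝ) ≤ ∫ t in a..b, c * torusEnstrophy (u t) := by
    rw [intervalIntegral.integral_of_le hab.le, intervalIntegral.integral_of_le hab.le]
    refine integral_mono_of_nonneg ?_ (hcont.integrableOn_Icc.mono_set Ioc_subset_Icc_self) ?_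
    · exact Filter.Eventually.of_forall fun t =>
        Real.rpow_nonneg (integral_nonneg fun x => by positivity) _
    · exact (ae_restrict_iff' measurableSet_Ioc).2 (Filter.Eventually.of_forall fun t ht =>
        rpow_third_integral_norm_pow_six_le_of_solution hd h hmean (Ioc_subset_Icc_self ht))
  have hE := kineticEnergy_sub_eq_neg_two_mul_integral_torusEnstrophy h (convex_Icc a b) hab.le
    Subset.rfl
  have hint : ∫ τ in a..b, torusEnstrophy (u τ) =
      (Torus.kineticEnergy (u a) - Torus.kineticEnergy (u b)) / (2 * ν) := by
    have hν0 : (2 : ℝ) * ν ≠ 0 := by positivity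
    field_simp
    linarith
  calc ∫ t in a..b, (∫ x, ‖u t x‖ ^ 6) ^ (1 / 3 : ℝ)
      ≤ ∫ t in a..b, c * torusEnstrophy (u t) := hmono
    _ = c * (Torus.kineticEnergy (u a) - Torus.kineticEnergy (u b)) / (2 * ν) := by
        rw [intervalIntegral.integral_const_mul, hint]
        ring

/-- **The integrand of (44) along a solution, `2 < q < 6`**, with the energy at time `t` replaced by
the initial energy (`K(u(t)) ≤ K(u(a))`):
`‖u(t)‖_{L^q}^{4q/(3(q−2))} ≤ (2K(u(a)))^{(6−q)/(3(q−2))} · c ℰ(u(t))`.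
[cite: Protas2026, §4.1, eq. (44), p. 62] -/
theorem rpow_integral_norm_rpow_le_of_solution (hd : Fintype.card d = 3) (hν : 0 < ν) {q : ℝ}
    (hq2 : 2 < q) (hq6 : q < 6) (h : Torus.IsClassicalNSSolutionOn (Icc a b) ν 0 u p)
    (hmean : ∀ t ∈ Icc a b, Torus.HasZeroMean (u t)) {t : ℝ} (ht : t ∈ Icc a b) :
    (∫ x, ‖u t x‖ ^ q) ^ (4 / (3 * (q - 2))) ≤
      (2 * Torus.kineticEnergy (u a)) ^ ((6 - q) / (3 * (q - 2))) *
        (lSixEnstrophyConst hd * torusEnstrophy (u t)) := by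
  have h1 := rpow_integral_norm_rpow_le_energy_rpow_mul_enstrophy hd hq2 hq6
    (h.smooth_velocity.isSmooth_slice ht) (hmean t ht)
  refine h1.trans (mul_le_mul_of_nonneg_right ?_
    (mul_nonneg (lSixEnstrophyConst_nonneg hd) (torusEnstrophy_nonneg _)))
  have hK : Torus.kineticEnergy (u t) ≤ Torus.kineticEnergy (u a) :=
    kineticEnergy_le_of_le hν.le h (convex_Icc a b) ht.1 (Icc_subset_Icc_right ht.2)
  have he : 0 ≤ (6 - q) / (3 * (q - 2)) := by
    have : 0 < q - 2 := by linarith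
    have : 0 ≤ 6 - q := by linarith
    positivity
  exact Real.rpow_le_rpow (by linarith [Torus.kineticEnergy_nonneg (u t)]) (by linarith) he

/-- **Eq. (44) on `T³`, `2 < q < 6`**: along a classical solution of the unforced Navier–Stokes
equations (`ν > 0`, mean-zero slices) on `[a, b]`,
`∫ₐᵇ ‖u(t)‖_{L^q}^{4q/(3(q−2))} dt ≤ (2K₀)^{(6−q)/(3(q−2))} · c (K₀ − K(u(b)))/(2ν)`, `K₀ = K(u(a))`,
i.e. `≤ c' K₀^{2q/(3(q−2))}/ν` (`aprioriEnergyExponent_add_one`). The whole supercritical gap of the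
essay is the difference between this exponent `4q/(3(q−2))` and the LPS exponent `2q/(q−3)`.
[cite: Protas2026, §4.1, eq. (44), p. 62] [cite: RobinsonRodrigoSadowskiCUP2016, Lemma 3.5] -/
theorem integral_rpow_integral_norm_rpow_le (hd : Fintype.card d = 3) (hν : 0 < ν) (hab : a < b)
    {q : ℝ} (hq2 : 2 < q) (hq6 : q < 6) (h : Torus.IsClassicalNSSolutionOn (Icc a b) ν 0 u p)
    (hmean : ∀ t ∈ Icc a b, Torus.HasZeroMean (u t)) :
    ∫ t in a..b, (∫ x, ‖u t x‖ ^ q) ^ (4 / (3 * (q - 2))) ≤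
      (2 * Torus.kineticEnergy (u a)) ^ ((6 - q) / (3 * (q - 2))) * lSixEnstrophyConst hd *
        (Torus.kineticEnergy (u a) - Torus.kineticEnergy (u b)) / (2 * ν) := by
  set M : ℝ := (2 * Torus.kineticEnergy (u a)) ^ ((6 - q) / (3 * (q - 2))) * lSixEnstrophyConst hd
    with hM
  have hcont : ContinuousOn (fun s => M * torusEnstrophy (u s)) (Icc a b) :=
    fun s hs => ((h.hasDerivWithinAt_half_gradNormSq hab hs).continuousWithinAt).const_smul M
  have hmono : ∫ t in a..b, (∫ x, ‖u t x‖ ^ q) ^ (4 / (3 * (q - 2))) ≤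
      ∫ t in a..b, M * torusEnstrophy (u t) := by
    rw [intervalIntegral.integral_of_le hab.le, intervalIntegral.integral_of_le hab.le]
    refine integral_mono_of_nonneg ?_ (hcont.integrableOn_Icc.mono_set Ioc_subset_Icc_self) ?_
    · exact Filter.Eventually.of_forall fun t =>
        Real.rpow_nonneg (integral_nonneg fun x => Real.rpow_nonneg (norm_nonneg _) _) _
    · refine (ae_restrict_iff' measurableSet_Ioc).2 (Filter.Eventually.of_forall fun t ht => ?_)
      have := rpow_integral_norm_rpow_le_of_solution hd hν hq2 hq6 h hmean (Ioc_subset_Icc_self ht)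
      simpa only [hM, mul_assoc] using this
  have hE := kineticEnergy_sub_eq_neg_two_mul_integral_torusEnstrophy h (convex_Icc a b) hab.le
    Subset.rfl
  have hint : ∫ τ in a..b, torusEnstrophy (u τ) =
      (Torus.kineticEnergy (u a) - Torus.kineticEnergy (u b)) / (2 * ν) := by
    have hν0 : (2 : ℝ) * ν ≠ 0 := by positivity
    field_simp
    linarith
  calc ∫ t in a..b, (∫ x, ‖u t x‖ ^ q) ^ (4 / (3 * (q - 2)))
      ≤ ∫ t in a..b, M * torusEnstrophy (u t) := hmono
    _ = M * (Torus.kineticEnergy (u a) - Torus.kineticEnergy (u b)) / (2 * ν) := by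
        rw [intervalIntegral.integral_const_mul, hint]
        ring

end APriori

/-! ## The lower edge of the `L^q` window (eq. (50), first line) as a no-blow-up theorem -/

section Edge

variable {ν a b : ℝ} {u : ℝ → UnitAddTorus d → EuclideanSpace ℝ d} {p : ℝ → UnitAddTorus d → ℝ}

/-- **Grönwall at the edge, `q = 6`.** Along a classical mean-zero solution on `[a, b]` (`ν > 0`):
if `y ≥ 0` has one-sided derivatives `y'` within `[a, b]` with `y'(t) ≤ A · y(t) · ‖u(t)‖_{L⁶}²`
(`A ≥ 0`; with `y = ‖u‖_{L⁶}` this is `d/dt‖u‖₆ ≤ A‖u‖₆³`, the edge `(7·6−6)/(3·4) = 3` of (50)), then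
`y(t) ≤ y(a) · exp(A c (K(u(a)) − K(u(t)))/(2ν))` for every `t ∈ [a, b]`.
[cite: Protas2026, §4.1, eq. (50), p. 65 (q = 6)] -/
theorem le_mul_exp_of_deriv_le_mul_rpow_third (hd : Fintype.card d = 3) (hν : 0 < ν) (hab : a < b)
    (h : Torus.IsClassicalNSSolutionOn (Icc a b) ν 0 u p)
    (hmean : ∀ t ∈ Icc a b, Torus.HasZeroMean (u t)) {y y' : ℝ → ℝ} {A : ℝ} (hA : 0 ≤ A)
    (hy : ∀ t ∈ Icc a b, HasDerivWithinAt y (y' t) (Icc a b) t) (hy0 : ∀ t ∈ Icc a b, 0 ≤ y t)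
    (hrate : ∀ t ∈ Icc a b, y' t ≤ A * y t * (∫ x, ‖u t x‖ ^ 6) ^ (1 / 3 : ℝ))
    {t : ℝ} (ht : t ∈ Icc a b) :
    y t ≤ y a * Real.exp (A * lSixEnstrophyConst hd *
      (Torus.kineticEnergy (u a) - Torus.kineticEnergy (u t)) / (2 * ν)) := by
  set c : ℝ := lSixEnstrophyConst hd with hc
  set k : ℝ → ℝ := fun s => A * c * torusEnstrophy (u s) with hk
  have hcont : ContinuousOn k (Icc a b) :=
    fun s hs => ((h.hasDerivWithinAt_half_gradNormSq hab hs).continuousWithinAt).const_smul (A * c)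
  have hle : ∀ s ∈ Icc a b, y' s ≤ k s * y s := by
    intro s hs
    have h6 := rpow_third_integral_norm_pow_six_le_of_solution hd h hmean hs
    have hAy : 0 ≤ A * y s := mul_nonneg hA (hy0 s hs)
    calc y' s ≤ A * y s * (∫ x, ‖u s x‖ ^ 6) ^ (1 / 3 : ℝ) := hrate s hs
      _ ≤ A * y s * (c * torusEnstrophy (u s)) := mul_le_mul_of_nonneg_left h6 hAy
      _ = k s * y s := by rw [hk]; ring
  have hG := le_mul_exp_integral_of_hasDerivWithinAt_le_mul hab hy hcont hle ht
  have hE := kineticEnergy_sub_eq_neg_two_mul_integral_torusEnstrophy h (convex_Icc a b) ht.1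
    (Icc_subset_Icc_right ht.2)
  have hint : ∫ τ in a..t, torusEnstrophy (u τ) =
      (Torus.kineticEnergy (u a) - Torus.kineticEnergy (u t)) / (2 * ν) := by
    have hν0 : (2 : ℝ) * ν ≠ 0 := by positivity
    field_simp
    linarith
  have hI : ∫ s in a..t, k s =
      A * c * (Torus.kineticEnergy (u a) - Torus.kineticEnergy (u t)) / (2 * ν) := by
    simp only [hk]
    rw [intervalIntegral.integral_const_mul, hint]
    ring
  rw [hI] at hG
  exact hG

/-- **`q = 6`, uniform in time**: under the same hypotheses `y(t) ≤ y(a) exp(A c K(u(a))/(2ν))` on the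
whole window — independent of `b`: a rate `d/dt‖u‖₆ ≤ A‖u‖₆³` sustained up to any time cannot blow
up. [cite: Protas2026, §4.1, eq. (50), p. 65 (q = 6)] -/
theorem le_mul_exp_energy_of_deriv_le_mul_rpow_third (hd : Fintype.card d = 3) (hν : 0 < ν)
    (hab : a < b) (h : Torus.IsClassicalNSSolutionOn (Icc a b) ν 0 u p)
    (hmean : ∀ t ∈ Icc a b, Torus.HasZeroMean (u t)) {y y' : ℝ → ℝ} {A : ℝ} (hA : 0 ≤ A)
    (hy : ∀ t ∈ Icc a b, HasDerivWithinAt y (y' t) (Icc a b) t) (hy0 : ∀ t ∈ Icc a b, 0 ≤ y t)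
    (hrate : ∀ t ∈ Icc a b, y' t ≤ A * y t * (∫ x, ‖u t x‖ ^ 6) ^ (1 / 3 : ℝ))
    {t : ℝ} (ht : t ∈ Icc a b) :
    y t ≤ y a * Real.exp (A * lSixEnstrophyConst hd * Torus.kineticEnergy (u a) / (2 * ν)) := by
  have h1 := le_mul_exp_of_deriv_le_mul_rpow_third hd hν hab h hmean hA hy hy0 hrate ht
  have hya : 0 ≤ y a := hy0 a (left_mem_Icc.2 hab.le)
  refine h1.trans (mul_le_mul_of_nonneg_left (Real.exp_le_exp.2 ?_) hya)
  have hKt : 0 ≤ Torus.kineticEnergy (u t) := Torus.kineticEnergy_nonneg _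
  have hAc : 0 ≤ A * lSixEnstrophyConst hd := mul_nonneg hA (lSixEnstrophyConst_nonneg hd)
  have hν2 : 0 < 2 * ν := by positivity
  have : A * lSixEnstrophyConst hd * (Torus.kineticEnergy (u a) - Torus.kineticEnergy (u t)) ≤
      A * lSixEnstrophyConst hd * Torus.kineticEnergy (u a) := by nlinarith
  exact div_le_div_of_nonneg_right this hν2.le

/-- **Grönwall at the edge, `2 < q < 6`.** Along a classical mean-zero solution on `[a, b]`
(`ν > 0`): if `y ≥ 0` has one-sided derivatives within `[a, b]` with
`y'(t) ≤ A · y(t) · ‖u(t)‖_{L^q}^{4q/(3(q−2))}` (`A ≥ 0`), then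
`y(t) ≤ y(a) · exp(A (2K₀)^{(6−q)/(3(q−2))} c (K₀ − K(u(t)))/(2ν))`, `K₀ = K(u(a))`, for every
`t ∈ [a, b]`. [cite: Protas2026, §4.1, eq. (50), p. 65] -/
theorem le_mul_exp_of_deriv_le_mul_lqFactor (hd : Fintype.card d = 3) (hν : 0 < ν) (hab : a < b)
    {q : ℝ} (hq2 : 2 < q) (hq6 : q < 6) (h : Torus.IsClassicalNSSolutionOn (Icc a b) ν 0 u p)
    (hmean : ∀ t ∈ Icc a b, Torus.HasZeroMean (u t)) {y y' : ℝ → ℝ} {A : ℝ} (hA : 0 ≤ A)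
    (hy : ∀ t ∈ Icc a b, HasDerivWithinAt y (y' t) (Icc a b) t) (hy0 : ∀ t ∈ Icc a b, 0 ≤ y t)
    (hrate : ∀ t ∈ Icc a b, y' t ≤ A * y t * (∫ x, ‖u t x‖ ^ q) ^ (4 / (3 * (q - 2))))
    {t : ℝ} (ht : t ∈ Icc a b) :
    y t ≤ y a * Real.exp (A * ((2 * Torus.kineticEnergy (u a)) ^ ((6 - q) / (3 * (q - 2))) *
      lSixEnstrophyConst hd) * (Torus.kineticEnergy (u a) - Torus.kineticEnergy (u t)) / (2 * ν)) := by
  set M : ℝ := (2 * Torus.kineticEnergy (u a)) ^ ((6 - q) / (3 * (q - 2))) * lSixEnstrophyConst hd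
    with hM
  set k : ℝ → ℝ := fun s => A * M * torusEnstrophy (u s) with hk
  have hcont : ContinuousOn k (Icc a b) :=
    fun s hs => ((h.hasDerivWithinAt_half_gradNormSq hab hs).continuousWithinAt).const_smul (A * M)
  have hle : ∀ s ∈ Icc a b, y' s ≤ k s * y s := by
    intro s hs
    have hq := rpow_integral_norm_rpow_le_of_solution hd hν hq2 hq6 h hmean hs
    have hAy : 0 ≤ A * y s := mul_nonneg hA (hy0 s hs)
    calc y' s ≤ A * y s * (∫ x, ‖u s x‖ ^ q) ^ (4 / (3 * (q - 2))) := hrate s hs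
      _ ≤ A * y s * ((2 * Torus.kineticEnergy (u a)) ^ ((6 - q) / (3 * (q - 2))) *
          (lSixEnstrophyConst hd * torusEnstrophy (u s))) := mul_le_mul_of_nonneg_left hq hAy
      _ = k s * y s := by rw [hk, hM]; ring
  have hG := le_mul_exp_integral_of_hasDerivWithinAt_le_mul hab hy hcont hle ht
  have hE := kineticEnergy_sub_eq_neg_two_mul_integral_torusEnstrophy h (convex_Icc a b) ht.1
    (Icc_subset_Icc_right ht.2)
  have hint : ∫ τ in a..t, torusEnstrophy (u τ) =
      (Torus.kineticEnergy (u a) - Torus.kineticEnergy (u t)) / (2 * ν) := by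
    have hν0 : (2 : ℝ) * ν ≠ 0 := by positivity
    field_simp
    linarith
  have hI : ∫ s in a..t, k s =
      A * M * (Torus.kineticEnergy (u a) - Torus.kineticEnergy (u t)) / (2 * ν) := by
    simp only [hk]
    rw [intervalIntegral.integral_const_mul, hint]
    ring
  rw [hI] at hG
  exact hG

/-- **The dictionary made literal (`2 < q < 6`)**: if `y(t) = ‖u(t)‖_{L^q} = (∫‖u(t)‖^q)^{1/q}` has
one-sided derivatives within `[a, b]` obeying the printed edge rate of (50),
`y'(t) ≤ A y(t)^{(7q−6)/(3(q−2))}` (`A ≥ 0`), then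
`‖u(t)‖_{L^q} ≤ ‖u(a)‖_{L^q} · exp(A (2K₀)^{(6−q)/(3(q−2))} c (K₀ − K(u(t)))/(2ν))` on `[a, b]`:
such a rate, sustained on any window, cannot blow up (the differentiability of the norm is assumed,
not proved). [cite: Protas2026, §4.1, eq. (50), p. 65] -/
theorem lqNorm_le_mul_exp_of_rate_le_rpow_edge (hd : Fintype.card d = 3) (hν : 0 < ν) (hab : a < b)
    {q : ℝ} (hq2 : 2 < q) (hq6 : q < 6) (h : Torus.IsClassicalNSSolutionOn (Icc a b) ν 0 u p)
    (hmean : ∀ t ∈ Icc a b, Torus.HasZeroMean (u t)) {y y' : ℝ → ℝ} {A : ℝ} (hA : 0 ≤ A)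
    (hyeq : ∀ t ∈ Icc a b, y t = (∫ x, ‖u t x‖ ^ q) ^ (1 / q))
    (hy : ∀ t ∈ Icc a b, HasDerivWithinAt y (y' t) (Icc a b) t)
    (hrate : ∀ t ∈ Icc a b, y' t ≤ A * y t ^ ((7 * q - 6) / (3 * (q - 2))))
    {t : ℝ} (ht : t ∈ Icc a b) :
    y t ≤ y a * Real.exp (A * ((2 * Torus.kineticEnergy (u a)) ^ ((6 - q) / (3 * (q - 2))) *
      lSixEnstrophyConst hd) * (Torus.kineticEnergy (u a) - Torus.kineticEnergy (u t)) / (2 * ν)) := by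
  have hIq : ∀ s ∈ Icc a b, 0 ≤ ∫ x, ‖u s x‖ ^ q :=
    fun s _ => integral_nonneg fun x => Real.rpow_nonneg (norm_nonneg _) _
  have hy0 : ∀ s ∈ Icc a b, 0 ≤ y s := fun s hs => by
    rw [hyeq s hs]
    exact Real.rpow_nonneg (hIq s hs) _
  have hrate' : ∀ s ∈ Icc a b, y' s ≤ A * y s * (∫ x, ‖u s x‖ ^ q) ^ (4 / (3 * (q - 2))) := by
    intro s hs
    have key : y s ^ ((7 * q - 6) / (3 * (q - 2))) = y s * (∫ x, ‖u s x‖ ^ q) ^ (4 / (3 * (q - 2))) := by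
      rw [hyeq s hs, ← rpow_inv_mul_rpow_aprioriFactor_eq (hIq s hs) hq2]
    have := hrate s hs
    rw [key, ← mul_assoc] at this
    exact this
  exact le_mul_exp_of_deriv_le_mul_lqFactor hd hν hab hq2 hq6 h hmean hA hy hy0 hrate' ht

/-- **`q = 6`, the dictionary made literal**: if `y(t) = ‖u(t)‖_{L⁶} = (∫‖u(t)‖⁶)^{1/6}` has one-sided
derivatives within `[a, b]` with `y'(t) ≤ A y(t)³` (`A ≥ 0`; the edge exponent `3` of (50) at
`q = 6`), then `‖u(t)‖_{L⁶} ≤ ‖u(a)‖_{L⁶} exp(A c K(u(a))/(2ν))` on `[a, b]`.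
[cite: Protas2026, §4.1, eq. (50), p. 65 (q = 6)] -/
theorem lSixNorm_le_mul_exp_of_rate_le_cube (hd : Fintype.card d = 3) (hν : 0 < ν) (hab : a < b)
    (h : Torus.IsClassicalNSSolutionOn (Icc a b) ν 0 u p)
    (hmean : ∀ t ∈ Icc a b, Torus.HasZeroMean (u t)) {y y' : ℝ → ℝ} {A : ℝ} (hA : 0 ≤ A)
    (hyeq : ∀ t ∈ Icc a b, y t = (∫ x, ‖u t x‖ ^ 6) ^ (1 / 6 : ℝ))
    (hy : ∀ t ∈ Icc a b, HasDerivWithinAt y (y' t) (Icc a b) t)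
    (hrate : ∀ t ∈ Icc a b, y' t ≤ A * y t ^ 3)
    {t : ℝ} (ht : t ∈ Icc a b) :
    y t ≤ y a * Real.exp (A * lSixEnstrophyConst hd * Torus.kineticEnergy (u a) / (2 * ν)) := by
  have hI6 : ∀ s ∈ Icc a b, 0 ≤ ∫ x, ‖u s x‖ ^ 6 :=
    fun s _ => integral_nonneg fun x => by positivity
  have hy0 : ∀ s ∈ Icc a b, 0 ≤ y s := fun s hs => by
    rw [hyeq s hs]
    exact Real.rpow_nonneg (hI6 s hs) _
  have hrate' : ∀ s ∈ Icc a b, y' s ≤ A * y s * (∫ x, ‖u s x‖ ^ 6) ^ (1 / 3 : ℝ) := by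
    intro s hs
    -- `y² = (I^{1/6})² = I^{1/3}`
    have hsq : y s ^ 2 = (∫ x, ‖u s x‖ ^ 6) ^ (1 / 3 : ℝ) := by
      rw [hyeq s hs, ← Real.rpow_natCast ((∫ x, ‖u s x‖ ^ 6) ^ (1 / 6 : ℝ)) 2,
        ← Real.rpow_mul (hI6 s hs)]
      norm_num
    have := hrate s hs
    calc y' s ≤ A * y s ^ 3 := this
      _ = A * y s * y s ^ 2 := by ring
      _ = A * y s * (∫ x, ‖u s x‖ ^ 6) ^ (1 / 3 : ℝ) := by rw [hsq]
  exact le_mul_exp_energy_of_deriv_le_mul_rpow_third hd hν hab h hmean hA hy hy0 hrate' ht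

end Edge

end Literature.Analysis.FluidPDE
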